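import Summits.AnomalousDissipation.AnomalousDissipation.Theorems.SawtoothPulseCascadeK1LocalisedCascadePhaseOneOffTubeSum
import Summits.AnomalousDissipation.AnomalousDissipation.Theorems.SawtoothPulseCascadeK1LocalisedCascadeVFibreTube
import Summits.AnomalousDissipation.AnomalousDissipation.Theorems.SawtoothPulseCascadeK1LocalisedCascadePhaseOneL1Tables000
import Summits.AnomalousDissipation.AnomalousDissipation.Theorems.SawtoothPulseCascadeK1LocalisedCascadePhaseOneL1Tables050
import Summits.AnomalousDissipation.AnomalousDissipation.Theorems.SawtoothPulseCascadeK1LocalisedCascadePhaseOneL1Tables100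
import Summits.AnomalousDissipation.AnomalousDissipation.Theorems.SawtoothPulseCascadeK1LocalisedCascadePhaseOneL1Tables150
import Summits.AnomalousDissipation.AnomalousDissipation.Theorems.SawtoothPulseCascadeK1LocalisedCascadePhaseOneL1Tables200
import Summits.AnomalousDissipation.AnomalousDissipation.Theorems.SawtoothPulseCascadeK1LocalisedCascadePhaseOneL1Tables250
import Summits.AnomalousDissipation.AnomalousDissipation.Theorems.SawtoothPulseCascadeK1LocalisedCascadePhaseOneL1Tables300
import Summits.AnomalousDissipation.AnomalousDissipation.Theorems.SawtoothPulseCascadeK1LocalisedCascadePhaseOneL1Tables350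

/-!
# K1loc explicit start, phase 1: THE OFF-TUBE ENERGY OF `b₁` AT `D₀ = 400` IS AT MOST `46/10⁴` («PhaseOneOffTubeBound»)

Helper file of the prover lane on the crux `K1LocalisedCascade` (stmt-AnomalousDissipation-19491), route `SawtoothPulseCascade`
(arbiter A24-6 (2): the `ε_offtube` number of the table campaign).  The numeric assembly of
`ε(400) := Σ'_k [400 ≤ ||k₁| − |8k₀||] ‖𝓕b₁(k)‖² ≤ 46/10⁴` from `PhaseOneOffTubeSum.phaseOne_offTube_fibre_sharp`
(`E = 175`, `Q_c = 50`, so `2E + Q_c = 400`), per-fibre Peter–Paul (`t = 1/5` between the table part and the `ℓ²` remainder,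
`u = 1/64` between the off-lobe mass and the rounding slope), the twenty `ℓ¹`-table blocks `hL2_range_50_*` of
`PhaseOneL1Tables*` (`Σ_q L̄(q)² = 1.1292`, `|q| ≤ 400`), the block weights `massT_blockOut_le` / `massT_blockIn_le`
(`offLobeMass_le_block`, `1/π² ≤ 0.101322`, each weight rounded up to 5 digits), the symmetry `q ↦ −q` of the majorant, the `ℓ²`
remainder `Σ_{|q| ≤ 400} R_q ≤ 146/10⁶` (`phaseOne_vRemainder_le`, `Q_c = 50`) and the H-tail `181/10⁶` (`phaseOne_hTail_le`).  Ledger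
line: `ε_offtube(400) ≤ 6/5·2·0.00146471 + 6·146/10⁶ + 181/10⁶ ≤ 46/10⁴`.  §1 block weights (real arithmetic on `M(q,175)`); §2 the
theorem.  No definitions; nothing about the crux. [cite: Grafakos2014, Prop. 3.1.2 (5), Prop. 3.2.7 (3)] [problem: turb]
-/
-- `Summit.<Summit>.<Problem>`: single-conjunct summit, the duplicate namespace segment is deliberate.
set_option linter.dupNamespace false

noncomputable section

namespace Summit.AnomalousDissipation.AnomalousDissipation.Theorems.SawtoothPulseCascade.K1Start

open MeasureTheory Filter Topology UnitAddTorus Complex AddCircle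
open scoped Real
open Literature.Analysis Literature.Analysis.FunctionSpaces Literature.Analysis.FunctionSpaces.Torus Literature.Analysis.FluidPDE
open Literature.Analysis.FluidPDE.ShearStage
open Literature.Analysis.FluidPDE.SawtoothCascade Literature.Analysis.FluidPDE.SawtoothCascade.CascadeParams
open Summit.AnomalousDissipation.AnomalousDissipation.Theorems.SawtoothPulseCascade.K1Window

/-! ## §1 Block weights of the per-fibre mass majorant `(65/64)·M(q,175) + 65·(2⁻²⁷|q|)²` -/

/-- **Block weight, blocks outside the inside region** (`4hi < 175`): for `lo ≤ |q| ≤ hi`,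
`(65/64)·M(q,175) + 65·(2⁻²⁷|q|)² ≤ (65/64)·0.101322·2(4hi)²/((175+4lo)·174·(175+8lo−1)) + 65·(2⁻²⁷hi)²`. [folklore] -/
theorem massT_blockOut_le (lo hi : ℕ) (hhi : 4 * (hi : ℤ) < 175) {q : ℤ} (hlo : (lo : ℤ) ≤ |q|) (hqhi : |q| ≤ hi) :
    (65 / 64 : ℝ) * (2 * ((4 * q : ℤ) : ℝ) ^ 2 / (π ^ 2 * (((175 : ℝ) + |((4 * q : ℤ) : ℝ)|) * (((175 : ℝ) - 1) * ((175 : ℝ) + 2 * |((4 * q : ℤ) : ℝ)| - 1)))) + (if (175 : ℤ) ≤ |(4 * q : ℤ)| then 1 / (π ^ 2 * ((175 : ℝ) - 1)) + 2 * (|((4 * q : ℤ) : ℝ)| - 175 + 1) / (π ^ 2 * (|((4 * q : ℤ) : ℝ)| * 175)) else 0)) + 65 * ((2 : ℝ)⁻¹ ^ 27 * |(q : ℝ)|) ^ 2 ≤ ((65 / 64 : ℝ) * (0.101322 * (2 * (4 * (hi : ℝ)) ^ 2 / (((175 : ℝ) + 4 * lo) * (((175 : ℝ) - 1) * ((175 :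 ℝ) + 8 * lo - 1))))) + 65 * ((2 : ℝ)⁻¹ ^ 27 * hi) ^ 2) := by
  have hπ : 0 < π := Real.pi_pos
  have h := offLobeMass_le_block (E := 175) (lo := lo) (hi := hi) (lo2 := 1) (by norm_num) one_pos hlo hqhi
    (fun h' => by push_cast at h'; linarith)
  have hneg : ¬ (((175 : ℕ) : ℤ) ≤ 4 * (hi : ℤ)) := by push_cast; omega
  rw [if_neg hneg, add_zero] at h
  have hlo0 : (0 : ℝ) ≤ lo := Nat.cast_nonneg _
  have hD : 0 < ((175 : ℝ) + 4 * lo) * (((175 : ℝ) - 1) * ((175 : ℝ) + 8 * lo - 1)) := by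
    have : (0 : ℝ) < (175 : ℝ) + 8 * lo - 1 := by linarith
    positivity
  have d := div_pi_sq_le (by positivity : (0 : ℝ) ≤ 2 * (4 * (hi : ℝ)) ^ 2) hD
  have hq : |(q : ℝ)| ≤ hi := by rw [← Int.cast_abs]; exact_mod_cast hqhi
  have ht : ((2 : ℝ)⁻¹ ^ 27 * |(q : ℝ)|) ^ 2 ≤ ((2 : ℝ)⁻¹ ^ 27 * hi) ^ 2 :=
    pow_le_pow_left₀ (by positivity) (mul_le_mul_of_nonneg_left hq (by positivity)) 2
  push_cast at h ⊢
  linarith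

/-- **Block weight, blocks meeting the inside region** (`175 ≤ 4hi`; the inside term is charged on `|q| ≥ lo₂`): for
`lo ≤ |q| ≤ hi` with `175 ≤ 4|q| ⇒ lo₂ ≤ |q|`, `(65/64)·M(q,175) + 65·(2⁻²⁷|q|)² ≤
(65/64)·0.101322·(2(4hi)²/((175+4lo)·174·(175+8lo−1)) + 1/174 + 2(4hi−174)/(4lo₂·175)) + 65·(2⁻²⁷hi)²`. [folklore] -/
theorem massT_blockIn_le (lo hi lo2 : ℕ) (hlo2 : 0 < lo2) (hhi : (175 : ℤ) ≤ 4 * (hi : ℤ)) {q : ℤ} (hlo : (lo : ℤ) ≤ |q|)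
    (hqhi : |q| ≤ hi) (hq2 : (175 : ℤ) ≤ 4 * |q| → (lo2 : ℤ) ≤ |q|) :
    (65 / 64 : ℝ) * (2 * ((4 * q : ℤ) : ℝ) ^ 2 / (π ^ 2 * (((175 : ℝ) + |((4 * q : ℤ) : ℝ)|) * (((175 : ℝ) - 1) * ((175 : ℝ) + 2 * |((4 * q : ℤ) : ℝ)| - 1)))) + (if (175 : ℤ) ≤ |(4 * q : ℤ)| then 1 / (π ^ 2 * ((175 : ℝ) - 1)) + 2 * (|((4 * q : ℤ) : ℝ)| - 175 + 1) / (π ^ 2 * (|((4 * q : ℤ) : ℝ)| * 175)) else 0)) + 65 * ((2 : ℝ)⁻¹ ^ 27 * |(q : ℝ)|) ^ 2 ≤ ((65 / 64 : ℝ) * (0.101322 * (2 * (4 * (hi : ℝ)) ^ 2 / (((175 : ℝ) + 4 * lo) * (((175 : ℝ) - 1) * ((175 : ℝ) + 8 * lo - 1))) + (1 / ((175 : ℝ) - 1) + 2 * (4 * (hi : ℝ) - 175 + 1) / (4 * (lo2 : ℝ) * 175)))) + 65 * ((2 : ℝ)⁻¹ ^ 27 * hi) ^ 2) := by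
  have hπ : 0 < π := Real.pi_pos
  have h := offLobeMass_le_block (E := 175) (lo := lo) (hi := hi) (lo2 := lo2) (by norm_num) hlo2 hlo hqhi
    (fun h' => hq2 (by push_cast at h'; exact h'))
  have hpos : ((175 : ℕ) : ℤ) ≤ 4 * (hi : ℤ) := by push_cast; exact hhi
  rw [if_pos hpos] at h
  have hlo0 : (0 : ℝ) ≤ lo := Nat.cast_nonneg _
  have hl2 : (0 : ℝ) < lo2 := by exact_mod_cast hlo2
  have hhi' : (0 : ℝ) ≤ 4 * (hi : ℝ) - 175 + 1 := by
    have : ((175 : ℤ) : ℝ) ≤ ((4 * hi : ℤ) : ℝ) := by exact_mod_cast hhi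
    push_cast at this; linarith
  have hD : 0 < ((175 : ℝ) + 4 * lo) * (((175 : ℝ) - 1) * ((175 : ℝ) + 8 * lo - 1)) := by
    have : (0 : ℝ) < (175 : ℝ) + 8 * lo - 1 := by linarith
    positivity
  have d1 := div_pi_sq_le (by positivity : (0 : ℝ) ≤ 2 * (4 * (hi : ℝ)) ^ 2) hD
  have d2 := div_pi_sq_le (by norm_num : (0 : ℝ) ≤ 1) (by norm_num : (0 : ℝ) < (175 : ℝ) - 1)
  have d3 := div_pi_sq_le (by positivity : (0 : ℝ) ≤ 2 * (4 * (hi : ℝ) - 175 + 1)) (by positivity : (0 : ℝ) < 4 * (lo2 : ℝ) * 175)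
  have hq : |(q : ℝ)| ≤ hi := by rw [← Int.cast_abs]; exact_mod_cast hqhi
  have ht : ((2 : ℝ)⁻¹ ^ 27 * |(q : ℝ)|) ^ 2 ≤ ((2 : ℝ)⁻¹ ^ 27 * hi) ^ 2 :=
    pow_le_pow_left₀ (by positivity) (mul_le_mul_of_nonneg_left hq (by positivity)) 2
  push_cast at h ⊢
  linarith

section Cascade

variable (P : CascadeParams) (hγ : P.γ = 8) (hN₀ : P.N₀ = 1) (hρN : P.ρN = 2) (hd : P.d = 2) (hδ₀ : 0 < P.δ₀)
  (hδ₀' : P.δ₀ ≤ (2 : ℝ)⁻¹ ^ 30) (a b : ℕ → UnitAddTorus (Fin 2) → ℝ) (h0 : a 0 = datum)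
  (hb : ∀ j, b j = a j ∘ shearMap 0 1 (amp ⟨P.U j, P.U_periodic j, P.contDiff_U (P.δ_pos hδ₀ (by rw [hd]; norm_num) j)⟩ P.γ))
  (hab : ∀ j, a (j + 1) = b j ∘ shearMap 1 0 (amp ⟨P.U j, P.U_periodic j, P.contDiff_U (P.δ_pos hδ₀ (by rw [hd]; norm_num) j)⟩ P.γ))

include hγ hN₀ hρN hd hδ₀' h0 hb hab

/-! ## §2 The off-tube energy at `D₀ = 400` -/

set_option maxHeartbeats 400000 in
/-- **THE OFF-TUBE ENERGY OF `b₁`** (`γ = 8`, `N₀ = 1`, `ρ_N = 2`, `d = 2`, `0 < δ₀ ≤ 2⁻³⁰`; `D₀ = 400 = 2·175 + 50`):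
`Σ'_k [400 ≤ ||k₁| − |8k₀||] ‖𝓕b₁(k)‖² ≤ 46/10⁴`. [cite: Grafakos2014, Prop. 3.1.2 (5), Prop. 3.2.7 (3)] -/
theorem phaseOne_offTube400_le :
    ∑' k : Fin 2 → ℤ, (if (400 : ℤ) ≤ |(|k 1| - |8 * k 0|)| then (1 : ℝ) else 0) *
      ‖mFourierCoeff (fun x => (b 1 x : ℂ)) k‖ ^ 2 ≤ 46 / 10 ^ 4 := by
  have hπ : 0 < π := Real.pi_pos
  have hd' : 0 < P.d := by rw [hd]; norm_num
  set ψ₀ : ShearProfile := amp ⟨P.U 0, P.U_periodic 0, P.contDiff_U (P.δ_pos hδ₀ hd' 0)⟩ P.γ with hψ₀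
  set ψ₁ : ShearProfile := amp ⟨P.U 1, P.U_periodic 1, P.contDiff_U (P.δ_pos hδ₀ hd' 1)⟩ P.γ with hψ₁
  have hb0 : b 0 = datum ∘ shearMap 0 1 ψ₀ := by rw [hb 0, h0]
  have ha1 : a 1 = b 0 ∘ shearMap 1 0 ψ₀ := hab 0
  have hb1 : b 1 = a 1 ∘ shearMap 0 1 ψ₁ := hb 1
  have ha1c : Continuous (a 1) := by
    rw [ha1, hb0]
    exact (isSmooth_datum_comp_shearMap ψ₀).continuous.comp (continuous_shearMap 1 0 ψ₀)
  have hb1c : Continuous (b 1) := by rw [hb1]; exact ha1c.comp (continuous_shearMap 0 1 ψ₁)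
  set c : (Fin 2 → ℤ) → ℝ := fun k => ‖mFourierCoeff (fun x => (b 1 x : ℂ)) k‖ ^ 2 with hc
  have hcs : Summable c := (hasSum_sq_mFourierCoeff_of_continuous (Complex.continuous_ofReal.comp hb1c)).summable
  have hc0 : ∀ k, 0 ≤ c k := fun k => sq_nonneg _
  set c' : (Fin 2 → ℤ) → ℝ := fun k => ‖mFourierCoeff (fun x => (a 1 x : ℂ)) k‖ ^ 2 with hc'
  have hcs' : Summable c' := (hasSum_sq_mFourierCoeff_of_continuous (Complex.continuous_ofReal.comp ha1c)).summable
  have hc0' : ∀ k, 0 ≤ c' k := fun k => sq_nonneg _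
  -- the per-fibre quantities (opaque local functions)
  obtain ⟨Lf, hLf⟩ : ∃ Lf : ℤ → ℝ, ∀ q, Lf q =
      ∑ q' ∈ (Finset.Icc (-(50 : ℤ)) 50).filter (fun q' => 1 ≤ |q'|), ‖mFourierCoeff (fun x => (a 1 x : ℂ)) ![q, q']‖ :=
    ⟨_, fun _ => rfl⟩
  obtain ⟨Rf, hRf⟩ : ∃ Rf : ℤ → ℝ, ∀ q, Rf q =
      ∑' q' : ℤ, (if q' ∈ (Finset.Icc (-(50 : ℤ)) 50).filter (fun q' => 1 ≤ |q'|) then 0 else c' ![q, q']) :=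
    ⟨_, fun _ => rfl⟩
  obtain ⟨M, hM⟩ : ∃ M : ℤ → ℝ, ∀ q, M q = (2 * ((4 * q : ℤ) : ℝ) ^ 2 / (π ^ 2 * (((175 : ℝ) + |((4 * q : ℤ) : ℝ)|) * (((175 : ℝ) - 1) * ((175 : ℝ) + 2 * |((4 * q : ℤ) : ℝ)| - 1)))) + (if (175 : ℤ) ≤ |(4 * q : ℤ)| then 1 / (π ^ 2 * ((175 : ℝ) - 1)) + 2 * (|((4 * q : ℤ) : ℝ)| - 175 + 1) / (π ^ 2 * (|((4 * q : ℤ) : ℝ)| * 175)) else 0)) := ⟨_, fun _ => rfl⟩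
  have hLf0 : ∀ q, 0 ≤ Lf q := fun q => by rw [hLf]; exact Finset.sum_nonneg fun _ _ => norm_nonneg _
  have hRf0 : ∀ q, 0 ≤ Rf q := fun q => by
    rw [hRf]; exact tsum_nonneg fun _ => by split_ifs; exacts [le_rfl, hc0' _]
  have hM0 : ∀ q, 0 ≤ M q := by
    intro q; rw [hM]
    refine add_nonneg ?_ ?_
    · have : (0 : ℝ) < (175 : ℝ) - 1 := by norm_num
      have : (0 : ℝ) < (175 : ℝ) + 2 * |((4 * q : ℤ) : ℝ)| - 1 := by
        have := abs_nonneg (((4 * q : ℤ)) : ℝ); linarith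
      positivity
    · split_ifs with h
      · have hEr : (175 : ℝ) ≤ |((4 * q : ℤ) : ℝ)| := by
          have : ((175 : ℤ) : ℝ) ≤ ((|(4 * q : ℤ)| : ℤ) : ℝ) := by exact_mod_cast h
          push_cast at this ⊢; exact this
        have : (0 : ℝ) ≤ |((4 * q : ℤ) : ℝ)| - 175 + 1 := by linarith
        have : (0 : ℝ) < |((4 * q : ℤ) : ℝ)| := by linarith
        have : (0 : ℝ) < (175 : ℝ) - 1 := by norm_num
        positivity
      · exact le_rfl
  -- `Mt q := (65/64) M q + 65 t_q²`, `t_q = 2⁻²⁷|q|` (Peter–Paul `u = 1/64`)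
  obtain ⟨Mt, hMt⟩ : ∃ Mt : ℤ → ℝ, ∀ q, Mt q = (65 / 64 : ℝ) * M q + 65 * ((2 : ℝ)⁻¹ ^ 27 * |(q : ℝ)|) ^ 2 :=
    ⟨_, fun _ => rfl⟩
  have hMt0 : ∀ q, 0 ≤ Mt q := fun q => by rw [hMt]; have := hM0 q; positivity
  have hρMt : ∀ q, (Real.sqrt (M q) + (2 : ℝ)⁻¹ ^ 27 * |(q : ℝ)|) ^ 2 ≤ Mt q := by
    intro q
    have h := add_sq_le_peterPaul (Real.sqrt (M q)) ((2 : ℝ)⁻¹ ^ 27 * |(q : ℝ)|) (by norm_num : (0 : ℝ) < 1 / 64)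
    rw [Real.sq_sqrt (hM0 q)] at h
    rw [hMt]; norm_num at h ⊢; linarith
  obtain ⟨Y, hY⟩ : ∃ Y : ℤ → ℝ, ∀ q, Y q = Mt q * Lf q ^ 2 := ⟨_, fun _ => rfl⟩
  have hY0 : ∀ q, 0 ≤ Y q := fun q => by rw [hY]; exact mul_nonneg (hMt0 q) (sq_nonneg _)
  obtain ⟨B, hB⟩ : ∃ B : ℤ → ℝ, ∀ q, B q = (6 / 5 : ℝ) * Y q + 6 * Rf q := ⟨_, fun _ => rfl⟩
  -- (a) one H-fibre off the tube: `Σ_W c(q,·) ≤ B q`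
  have hfib : ∀ q : ℤ, ∀ W : Finset ℤ, (∀ l ∈ W, (400 : ℤ) ≤ |(|l| - |8 * q|)|) → ∑ l ∈ W, c ![q, l] ≤ B q := by
    intro q W hW
    have hL : ∑ q' ∈ (Finset.Icc (-((50 : ℕ) : ℤ)) (50 : ℕ)).filter (fun q' => 1 ≤ |q'|),
        ‖mFourierCoeff (fun x => (a 1 x : ℂ)) ![q, q']‖ ≤ Lf q := le_of_eq (by rw [hLf]; push_cast; rfl)
    have hf := phaseOne_offTube_fibre_sharp P hγ hN₀ hρN hd hδ₀ hδ₀' a b h0 hb hab q 50 400 175 (by norm_num)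
      (by norm_num) hL W (fun l hl => by exact_mod_cast hW l hl)
    have h1 : ∑ l ∈ W, c ![q, l] ≤
        (Lf q * (Real.sqrt (M q) + (2 : ℝ)⁻¹ ^ 27 * |(q : ℝ)|) + Real.sqrt (Rf q)) ^ 2 := by
      simp only [hc]
      rw [hM q, hRf q]
      simp only [hc']
      push_cast at hf ⊢
      exact hf
    have hpp := add_sq_le_peterPaul (Lf q * (Real.sqrt (M q) + (2 : ℝ)⁻¹ ^ 27 * |(q : ℝ)|)) (Real.sqrt (Rf q))
      (by norm_num : (0 : ℝ) < 1 / 5)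
    rw [Real.sq_sqrt (hRf0 q), mul_pow] at hpp
    have h3 : Lf q ^ 2 * (Real.sqrt (M q) + (2 : ℝ)⁻¹ ^ 27 * |(q : ℝ)|) ^ 2 ≤ Lf q ^ 2 * Mt q :=
      mul_le_mul_of_nonneg_left (hρMt q) (sq_nonneg _)
    rw [hB, hY]
    norm_num at hpp ⊢
    linarith
  -- (b) the H-tail of `b₁` beyond `|k₀| > 400` (H-invariance, then `phaseOne_hTail_le`)
  have hτ : ∑' k : Fin 2 → ℤ, (if ((400 : ℕ) : ℤ) < |k 0| then (1 : ℝ) else 0) * c k ≤ 181 / 10 ^ 6 := by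
    have e := tsum_horizontalWeight_hstep ha1c ψ₁ hb1 (w := fun m : ℤ => if ((400 : ℕ) : ℤ) < |m| then (1 : ℝ) else 0)
      (C := 1) (fun m => by split_ifs <;> simp)
    simp only [hc]
    rw [e]
    have e2 : (fun k : Fin 2 → ℤ => (if ((400 : ℕ) : ℤ) < |k 0| then (1 : ℝ) else 0) *
        ‖mFourierCoeff (fun x => (a 1 x : ℂ)) k‖ ^ 2) =
        fun k => (if (401 : ℤ) ≤ |k 0| then (1 : ℝ) else 0) * ‖mFourierCoeff (fun x => (a 1 x : ℂ)) k‖ ^ 2 := by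
      funext k
      have : (((400 : ℕ) : ℤ) < |k 0|) ↔ ((401 : ℤ) ≤ |k 0|) := by push_cast; omega
      simp only [this]
    rw [e2]
    exact phaseOne_hTail_le P hγ hN₀ hδ₀ hδ₀' hd' a b h0 (hb 0) (hab 0)
  -- (c) fibres to lattice
  have hBq : ∀ q : ℤ, |q| ≤ ((400 : ℕ) : ℤ) → ∀ W : Finset ℤ,
      (∀ l ∈ W, (fun k : Fin 2 → ℤ => if (400 : ℤ) ≤ |(|k 1| - |8 * k 0|)| then (1 : ℝ) else 0) ![q, l] = 1) →
      ∑ l ∈ W, c ![q, l] ≤ B q := by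
    intro q _ W hW
    refine hfib q W fun l hl => ?_
    have h := hW l hl
    simp only [Matrix.cons_val_one, Matrix.cons_val_zero] at h
    by_contra h'
    rw [if_neg h'] at h
    norm_num at h
  have hmain := tsum_indicator_le_of_fibres c hcs hc0
    (fun k : Fin 2 → ℤ => if (400 : ℤ) ≤ |(|k 1| - |8 * k 0|)| then (1 : ℝ) else 0)
    (fun k => by
      by_cases h : (400 : ℤ) ≤ |(|k 1| - |8 * k 0|)|
      · exact Or.inr (if_pos h)
      · exact Or.inl (if_neg h)) 400 B hBq hτ
  refine hmain.trans ?_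
  -- (d) the `ℓ²` remainders
  have hR : ∑ q ∈ Finset.Icc (-((400 : ℕ) : ℤ)) (400 : ℕ), Rf q ≤ 146 / 10 ^ 6 := by
    simp only [hRf]
    refine (sum_fibre_lineCompl_le_tsum c' hcs' hc0' _ _).trans ?_
    have hv := phaseOne_vRemainder_le P hγ hN₀ hδ₀ hδ₀' hd' a b h0 (hb 0) (hab 0) 50 (by norm_num)
    have hSiff : ∀ q' : ℤ, q' ∈ (Finset.Icc (-(50 : ℤ)) 50).filter (fun q' => 1 ≤ |q'|) ↔
        (1 ≤ |q'| ∧ |q'| ≤ ((50 : ℕ) : ℤ)) := by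
      intro q'
      rw [Finset.mem_filter, Finset.mem_Icc, ← abs_le]
      push_cast
      tauto
    have e : ∑' k : Fin 2 → ℤ, (if k 1 ∈ (Finset.Icc (-(50 : ℤ)) 50).filter (fun q' => 1 ≤ |q'|) then (0 : ℝ) else 1) * c' k =
        ∑' k : Fin 2 → ℤ, (if 1 ≤ |k 1| ∧ |k 1| ≤ ((50 : ℕ) : ℤ) then (0 : ℝ) else 1) * c' k := by
      refine tsum_congr fun k => ?_
      by_cases hq : 1 ≤ |k 1| ∧ |k 1| ≤ ((50 : ℕ) : ℤ)
      · rw [if_pos hq, if_pos ((hSiff (k 1)).2 hq)]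
      · rw [if_neg hq, if_neg (fun h => hq ((hSiff (k 1)).1 h))]
    rw [e]
    refine hv.trans ?_
    have hs : Real.sqrt (2 * (2 * |((8 : ℤ) : ℝ)| * 0.31831) ^ 2 *
        ((((50 + 1 : ℕ) : ℝ)) ^ 2 / (((50 + 1 : ℕ) : ℝ) ^ 2 - ((8 : ℤ) : ℝ) ^ 2)) ^ 2 /
          (3 * (((50 + 1 : ℕ) : ℝ) - 2) * (((50 + 1 : ℕ) : ℝ) - 1) * ((50 + 1 : ℕ) : ℝ))) ≤ 0.012066 := by
      rw [Real.sqrt_le_left (by norm_num)]; norm_num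
    have h0 := Real.sqrt_nonneg (2 * (2 * |((8 : ℤ) : ℝ)| * 0.31831) ^ 2 *
        ((((50 + 1 : ℕ) : ℝ)) ^ 2 / (((50 + 1 : ℕ) : ℝ) ^ 2 - ((8 : ℤ) : ℝ) ^ 2)) ^ 2 /
          (3 * (((50 + 1 : ℕ) : ℝ) - 2) * (((50 + 1 : ℕ) : ℝ) - 1) * ((50 + 1 : ℕ) : ℝ)))
    nlinarith
  -- (e) symmetry `q ↦ −q` of `Y`
  have hLfneg : ∀ q, Lf (-q) = Lf q := by
    intro q
    rw [hLf, hLf]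
    have hSneg : ∀ q' : ℤ, q' ∈ (Finset.Icc (-(50 : ℤ)) 50).filter (fun q' => 1 ≤ |q'|) ↔
        -q' ∈ (Finset.Icc (-(50 : ℤ)) 50).filter (fun q' => 1 ≤ |q'|) := by
      intro q'
      rw [Finset.mem_filter, Finset.mem_filter, Finset.mem_Icc, Finset.mem_Icc, abs_neg]
      omega
    refine Finset.sum_equiv (Equiv.neg ℤ) (fun q' => by simpa using hSneg q') (fun q' _ => ?_)
    simp only [Equiv.neg_apply]
    rw [← norm_mFourierCoeff_neg_real (a 1) ![q, -q']]
    congr 2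
    ext i; fin_cases i <;> simp
  have hMneg : ∀ q, M (-q) = M q := by
    intro q; rw [hM, hM]; push_cast; simp only [mul_neg, abs_neg, neg_sq]
  have hYneg : ∀ q, Y (-q) = Y q := by
    intro q; rw [hY, hY, hMt, hMt, hMneg, hLfneg]; push_cast; rw [abs_neg]
  have hsymm : ∑ q ∈ Finset.Icc (-((400 : ℕ) : ℤ)) (400 : ℕ), Y q ≤ 2 * ∑ q ∈ Finset.Icc (0 : ℤ) 400, Y q := by
    have hsplit : Finset.Icc (-((400 : ℕ) : ℤ)) (400 : ℕ) = Finset.Icc (-(400 : ℤ)) (-1) ∪ Finset.Icc (0 : ℤ) 400 := by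
      ext q; simp only [Finset.mem_union, Finset.mem_Icc]; push_cast; omega
    have hdisj : Disjoint (Finset.Icc (-(400 : ℤ)) (-1)) (Finset.Icc (0 : ℤ) 400) := by
      rw [Finset.disjoint_left]; intro q h1 h2; rw [Finset.mem_Icc] at h1 h2; omega
    rw [hsplit, Finset.sum_union hdisj]
    have hneg : ∑ q ∈ Finset.Icc (-(400 : ℤ)) (-1), Y q = ∑ q ∈ Finset.Icc (1 : ℤ) 400, Y q := by
      refine Finset.sum_equiv (Equiv.neg ℤ) (fun q => ?_) (fun q _ => ?_)
      · simp only [Equiv.neg_apply, Finset.mem_Icc]; omega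
      · simp only [Equiv.neg_apply]; rw [hYneg q]
    rw [hneg]
    have hsub : Finset.Icc (1 : ℤ) 400 ⊆ Finset.Icc (0 : ℤ) 400 := fun q hq => by
      rw [Finset.mem_Icc] at hq ⊢; omega
    have := Finset.sum_le_sum_of_subset_of_nonneg hsub fun q _ _ => hY0 q
    linarith
  have hIcc := sum_Icc_eq_sum_range_shift Y ((0 : ℕ) : ℤ) 400
  -- (f) the table blocks: `Σ_{block} Y ≤ (block weight)·(Σ_{block} L̄²)`
  obtain ⟨Wo, hWo⟩ : ∃ Wo : ℕ → ℕ → ℝ, ∀ lo hi : ℕ, Wo lo hi = ((65 / 64 : ℝ) * (0.101322 * (2 * (4 * (hi : ℝ)) ^ 2 / (((175 : ℝ) + 4 * lo) * (((175 : ℝ) - 1) * ((175 : ℝ) + 8 * lo - 1))))) + 65 * ((2 : ℝ)⁻¹ ^ 27 * hi) ^ 2) := ⟨_, fun _ _ => rfl⟩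
  obtain ⟨Wn, hWn⟩ : ∃ Wn : ℕ → ℕ → ℕ → ℝ, ∀ lo hi lo2 : ℕ, Wn lo hi lo2 = ((65 / 64 : ℝ) * (0.101322 * (2 * (4 * (hi : ℝ)) ^ 2 / (((175 : ℝ) + 4 * lo) * (((175 : ℝ) - 1) * ((175 : ℝ) + 8 * lo - 1))) + (1 / ((175 : ℝ) - 1) + 2 * (4 * (hi : ℝ) - 175 + 1) / (4 * (lo2 : ℝ) * 175)))) + 65 * ((2 : ℝ)⁻¹ ^ 27 * hi) ^ 2) := ⟨_, fun _ _ _ => rfl⟩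
  have hblkOut : ∀ lo hi : ℕ, 4 * (hi : ℤ) < 175 → lo ≤ hi → ∀ {C w : ℝ}, 0 ≤ C → Wo lo hi ≤ w →
      ∑ i ∈ Finset.range (hi - lo + 1), Lf ((lo : ℤ) + (i : ℕ)) ^ 2 ≤ C →
      ∑ i ∈ Finset.range (hi - lo + 1), Y ((lo : ℤ) + (i : ℕ)) ≤ w * C := by
    intro lo hi hhi hlohi C w hC hw hT
    have hMtle : ∀ q : ℤ, (lo : ℤ) ≤ |q| → |q| ≤ hi → Mt q ≤ Wo lo hi := fun q h1 h2 => by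
      rw [hMt, hM, hWo]; exact massT_blockOut_le lo hi hhi h1 h2
    have hWb : 0 ≤ Wo lo hi := (hMt0 hi).trans (hMtle hi (by rw [Nat.abs_cast]; exact_mod_cast hlohi) (by rw [Nat.abs_cast]))
    simp only [hY]
    exact (block_bound hMt0 hlohi hMtle hWb hT).trans (mul_le_mul_of_nonneg_right hw hC)
  have hblkIn : ∀ lo hi lo2 : ℕ, 0 < lo2 → (175 : ℤ) ≤ 4 * (hi : ℤ) → (lo2 ≤ lo ∨ 4 * ((lo2 : ℤ) - 1) < 175) → lo ≤ hi →
      ∀ {C w : ℝ}, 0 ≤ C → Wn lo hi lo2 ≤ w → ∑ i ∈ Finset.range (hi - lo + 1), Lf ((lo : ℤ) + (i : ℕ)) ^ 2 ≤ C →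
      ∑ i ∈ Finset.range (hi - lo + 1), Y ((lo : ℤ) + (i : ℕ)) ≤ w * C := by
    intro lo hi lo2 hlo2 hhi hlo2' hlohi C w hC hw hT
    have hMtle : ∀ q : ℤ, (lo : ℤ) ≤ |q| → |q| ≤ hi → Mt q ≤ Wn lo hi lo2 := fun q h1 h2 => by
      rw [hMt, hM, hWn]
      refine massT_blockIn_le lo hi lo2 hlo2 hhi h1 h2 (fun h => ?_)
      rcases hlo2' with h' | h'
      · exact le_trans (by exact_mod_cast h') h1
      · generalize |q| = n at h ⊢; omega
    have hWb : 0 ≤ Wn lo hi lo2 :=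
      (hMt0 hi).trans (hMtle hi (by rw [Nat.abs_cast]; exact_mod_cast hlohi) (by rw [Nat.abs_cast]))
    simp only [hY]
    exact (block_bound hMt0 hlohi hMtle hWb hT).trans (mul_le_mul_of_nonneg_right hw hC)

  have b0 : ∑ i ∈ Finset.range (9 - 0 + 1), Y (((0 : ℕ) : ℤ) + (i : ℕ)) ≤ (0.000050343 : ℝ) * (0.02403935 : ℝ) :=
    hblkOut 0 9 (by norm_num) (by norm_num) (by norm_num) (by rw [hWo]; norm_num)
      (by simp only [hLf]; exact hL2_range_50_0_9 P hγ hN₀ hd hδ₀ hδ₀' a b h0 hb hab)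
  have b1 : ∑ i ∈ Finset.range (19 - 10 + 1), Y (((10 : ℕ) : ℤ) + (i : ℕ)) ≤ (0.00012511 : ℝ) * (0.01367305 : ℝ) :=
    hblkOut 10 19 (by norm_num) (by norm_num) (by norm_num) (by rw [hWo]; norm_num)
      (by simp only [hLf]; exact hL2_range_50_10_19 P hγ hN₀ hd hδ₀ hδ₀' a b h0 hb hab)
  have b2 : ∑ i ∈ Finset.range (29 - 20 + 1), Y (((20 : ℕ) : ℤ) + (i : ℕ)) ≤ (0.00018688 : ℝ) * (0.03194477 : ℝ) :=
    hblkOut 20 29 (by norm_num) (by norm_num) (by norm_num) (by rw [hWo]; norm_num)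
      (by simp only [hLf]; exact hL2_range_50_20_29 P hγ hN₀ hd hδ₀ hδ₀' a b h0 hb hab)
  have b3 : ∑ i ∈ Finset.range (39 - 30 + 1), Y (((30 : ℕ) : ℤ) + (i : ℕ)) ≤ (0.00023570 : ℝ) * (0.02781964 : ℝ) :=
    hblkOut 30 39 (by norm_num) (by norm_num) (by norm_num) (by rw [hWo]; norm_num)
      (by simp only [hLf]; exact hL2_range_50_30_39 P hγ hN₀ hd hδ₀ hδ₀' a b h0 hb hab)
  have b4 : ∑ i ∈ Finset.range (49 - 40 + 1), Y (((40 : ℕ) : ℤ) + (i : ℕ)) ≤ (0.0010130 : ℝ) * (0.04892966 : ℝ) :=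
    hblkIn 40 49 44 (by norm_num) (by norm_num) (by norm_num) (by norm_num) (by norm_num) (by rw [hWn]; norm_num)
      (by simp only [hLf]; exact hL2_range_50_40_49 P hγ hN₀ hd hδ₀ hδ₀' a b h0 hb hab)
  have b5 : ∑ i ∈ Finset.range (59 - 50 + 1), Y (((50 : ℕ) : ℤ) + (i : ℕ)) ≤ (0.0012621 : ℝ) * (0.2497447 : ℝ) :=
    hblkIn 50 59 50 (by norm_num) (by norm_num) (by norm_num) (by norm_num) (by norm_num) (by rw [hWn]; norm_num)
      (by simp only [hLf]; exact hL2_range_50_50_59 P hγ hN₀ hd hδ₀ hδ₀' a b h0 hb hab)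
  have b6 : ∑ i ∈ Finset.range (69 - 60 + 1), Y (((60 : ℕ) : ℤ) + (i : ℕ)) ≤ (0.0014233 : ℝ) * (0.4751593 : ℝ) :=
    hblkIn 60 69 60 (by norm_num) (by norm_num) (by norm_num) (by norm_num) (by norm_num) (by rw [hWn]; norm_num)
      (by simp only [hLf]; exact hL2_range_50_60_69 P hγ hN₀ hd hδ₀ hδ₀' a b h0 hb hab)
  have b7 : ∑ i ∈ Finset.range (79 - 70 + 1), Y (((70 : ℕ) : ℤ) + (i : ℕ)) ≤ (0.0015415 : ℝ) * (0.1934633 : ℝ) :=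
    hblkIn 70 79 70 (by norm_num) (by norm_num) (by norm_num) (by norm_num) (by norm_num) (by rw [hWn]; norm_num)
      (by simp only [hLf]; exact hL2_range_50_70_79 P hγ hN₀ hd hδ₀ hδ₀' a b h0 hb hab)
  have b8 : ∑ i ∈ Finset.range (89 - 80 + 1), Y (((80 : ℕ) : ℤ) + (i : ℕ)) ≤ (0.0016324 : ℝ) * (0.02741689 : ℝ) :=
    hblkIn 80 89 80 (by norm_num) (by norm_num) (by norm_num) (by norm_num) (by norm_num) (by rw [hWn]; norm_num)
      (by simp only [hLf]; exact hL2_range_50_80_89 P hγ hN₀ hd hδ₀ hδ₀' a b h0 hb hab)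
  have b9 : ∑ i ∈ Finset.range (99 - 90 + 1), Y (((90 : ℕ) : ℤ) + (i : ℕ)) ≤ (0.0017045 : ℝ) * (0.009950337 : ℝ) :=
    hblkIn 90 99 90 (by norm_num) (by norm_num) (by norm_num) (by norm_num) (by norm_num) (by rw [hWn]; norm_num)
      (by simp only [hLf]; exact hL2_range_50_90_99 P hγ hN₀ hd hδ₀ hδ₀' a b h0 hb hab)
  have b10 : ∑ i ∈ Finset.range (109 - 100 + 1), Y (((100 : ℕ) : ℤ) + (i : ℕ)) ≤ (0.0017633 : ℝ) * (0.009227542 : ℝ) :=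
    hblkIn 100 109 100 (by norm_num) (by norm_num) (by norm_num) (by norm_num) (by norm_num) (by rw [hWn]; norm_num)
      (by simp only [hLf]; exact hL2_range_50_100_109 P hγ hN₀ hd hδ₀ hδ₀' a b h0 hb hab)
  have b11 : ∑ i ∈ Finset.range (119 - 110 + 1), Y (((110 : ℕ) : ℤ) + (i : ℕ)) ≤ (0.0018121 : ℝ) * (0.003148882 : ℝ) :=
    hblkIn 110 119 110 (by norm_num) (by norm_num) (by norm_num) (by norm_num) (by norm_num) (by rw [hWn]; norm_num)
      (by simp only [hLf]; exact hL2_range_50_110_119 P hγ hN₀ hd hδ₀ hδ₀' a b h0 hb hab)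
  have b12 : ∑ i ∈ Finset.range (129 - 120 + 1), Y (((120 : ℕ) : ℤ) + (i : ℕ)) ≤ (0.0018534 : ℝ) * (0.003227664 : ℝ) :=
    hblkIn 120 129 120 (by norm_num) (by norm_num) (by norm_num) (by norm_num) (by norm_num) (by rw [hWn]; norm_num)
      (by simp only [hLf]; exact hL2_range_50_120_129 P hγ hN₀ hd hδ₀ hδ₀' a b h0 hb hab)
  have b13 : ∑ i ∈ Finset.range (139 - 130 + 1), Y (((130 : ℕ) : ℤ) + (i : ℕ)) ≤ (0.0018888 : ℝ) * (0.00237088 : ℝ) :=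
    hblkIn 130 139 130 (by norm_num) (by norm_num) (by norm_num) (by norm_num) (by norm_num) (by rw [hWn]; norm_num)
      (by simp only [hLf]; exact hL2_range_50_130_139 P hγ hN₀ hd hδ₀ hδ₀' a b h0 hb hab)
  have b14 : ∑ i ∈ Finset.range (149 - 140 + 1), Y (((140 : ℕ) : ℤ) + (i : ℕ)) ≤ (0.0019195 : ℝ) * (0.000870717 : ℝ) :=
    hblkIn 140 149 140 (by norm_num) (by norm_num) (by norm_num) (by norm_num) (by norm_num) (by rw [hWn]; norm_num)
      (by simp only [hLf]; exact hL2_range_50_140_149 P hγ hN₀ hd hδ₀ hδ₀' a b h0 hb hab)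
  have b15 : ∑ i ∈ Finset.range (199 - 150 + 1), Y (((150 : ℕ) : ℤ) + (i : ℕ)) ≤ (0.0025145 : ℝ) * (0.003591456 : ℝ) :=
    hblkIn 150 199 150 (by norm_num) (by norm_num) (by norm_num) (by norm_num) (by norm_num) (by rw [hWn]; norm_num)
      (by simp only [hLf]; exact hL2_range_50_150_199 P hγ hN₀ hd hδ₀ hδ₀' a b h0 hb hab)
  have b16 : ∑ i ∈ Finset.range (249 - 200 + 1), Y (((200 : ℕ) : ℤ) + (i : ℕ)) ≤ (0.0024782 : ℝ) * (0.001200026 : ℝ) :=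
    hblkIn 200 249 200 (by norm_num) (by norm_num) (by norm_num) (by norm_num) (by norm_num) (by rw [hWn]; norm_num)
      (by simp only [hLf]; exact hL2_range_50_200_249 P hγ hN₀ hd hδ₀ hδ₀' a b h0 hb hab)
  have b17 : ∑ i ∈ Finset.range (299 - 250 + 1), Y (((250 : ℕ) : ℤ) + (i : ℕ)) ≤ (0.0024557 : ℝ) * (0.0004971768 : ℝ) :=
    hblkIn 250 299 250 (by norm_num) (by norm_num) (by norm_num) (by norm_num) (by norm_num) (by rw [hWn]; norm_num)
      (by simp only [hLf]; exact hL2_range_50_250_299 P hγ hN₀ hd hδ₀ hδ₀' a b h0 hb hab)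
  have b18 : ∑ i ∈ Finset.range (349 - 300 + 1), Y (((300 : ℕ) : ℤ) + (i : ℕ)) ≤ (0.0024404 : ℝ) * (0.0002454642 : ℝ) :=
    hblkIn 300 349 300 (by norm_num) (by norm_num) (by norm_num) (by norm_num) (by norm_num) (by rw [hWn]; norm_num)
      (by simp only [hLf]; exact hL2_range_50_300_349 P hγ hN₀ hd hδ₀ hδ₀' a b h0 hb hab)
  have b19 : ∑ i ∈ Finset.range (400 - 350 + 1), Y (((350 : ℕ) : ℤ) + (i : ℕ)) ≤ (0.0024358 : ℝ) * (0.000132394 : ℝ) :=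
    hblkIn 350 400 350 (by norm_num) (by norm_num) (by norm_num) (by norm_num) (by norm_num) (by rw [hWn]; norm_num)
      (by simp only [hLf]; exact hL2_range_50_350_400 P hγ hN₀ hd hδ₀ hδ₀' a b h0 hb hab)
  have s0 := sum_range_split_shift Y 401 10 391 (by norm_num) (((0 : ℕ) : ℤ)) (((10 : ℕ) : ℤ)) (by norm_num)
  have s1 := sum_range_split_shift Y 391 10 381 (by norm_num) (((10 : ℕ) : ℤ)) (((20 : ℕ) : ℤ)) (by norm_num)
  have s2 := sum_range_split_shift Y 381 10 371 (by norm_num) (((20 : ℕ) : ℤ)) (((30 : ℕ) : ℤ)) (by norm_num)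
  have s3 := sum_range_split_shift Y 371 10 361 (by norm_num) (((30 : ℕ) : ℤ)) (((40 : ℕ) : ℤ)) (by norm_num)
  have s4 := sum_range_split_shift Y 361 10 351 (by norm_num) (((40 : ℕ) : ℤ)) (((50 : ℕ) : ℤ)) (by norm_num)
  have s5 := sum_range_split_shift Y 351 10 341 (by norm_num) (((50 : ℕ) : ℤ)) (((60 : ℕ) : ℤ)) (by norm_num)
  have s6 := sum_range_split_shift Y 341 10 331 (by norm_num) (((60 : ℕ) : ℤ)) (((70 : ℕ) : ℤ)) (by norm_num)
  have s7 := sum_range_split_shift Y 331 10 321 (by norm_num) (((70 : ℕ) : ℤ)) (((80 : ℕ) : ℤ)) (by norm_num)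
  have s8 := sum_range_split_shift Y 321 10 311 (by norm_num) (((80 : ℕ) : ℤ)) (((90 : ℕ) : ℤ)) (by norm_num)
  have s9 := sum_range_split_shift Y 311 10 301 (by norm_num) (((90 : ℕ) : ℤ)) (((100 : ℕ) : ℤ)) (by norm_num)
  have s10 := sum_range_split_shift Y 301 10 291 (by norm_num) (((100 : ℕ) : ℤ)) (((110 : ℕ) : ℤ)) (by norm_num)
  have s11 := sum_range_split_shift Y 291 10 281 (by norm_num) (((110 : ℕ) : ℤ)) (((120 : ℕ) : ℤ)) (by norm_num)
  have s12 := sum_range_split_shift Y 281 10 271 (by norm_num) (((120 : ℕ) : ℤ)) (((130 : ℕ) : ℤ)) (by norm_num)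
  have s13 := sum_range_split_shift Y 271 10 261 (by norm_num) (((130 : ℕ) : ℤ)) (((140 : ℕ) : ℤ)) (by norm_num)
  have s14 := sum_range_split_shift Y 261 10 251 (by norm_num) (((140 : ℕ) : ℤ)) (((150 : ℕ) : ℤ)) (by norm_num)
  have s15 := sum_range_split_shift Y 251 50 201 (by norm_num) (((150 : ℕ) : ℤ)) (((200 : ℕ) : ℤ)) (by norm_num)
  have s16 := sum_range_split_shift Y 201 50 151 (by norm_num) (((200 : ℕ) : ℤ)) (((250 : ℕ) : ℤ)) (by norm_num)
  have s17 := sum_range_split_shift Y 151 50 101 (by norm_num) (((250 : ℕ) : ℤ)) (((300 : ℕ) : ℤ)) (by norm_num)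
  have s18 := sum_range_split_shift Y 101 50 51 (by norm_num) (((300 : ℕ) : ℤ)) (((350 : ℕ) : ℤ)) (by norm_num)
  -- (g) assembly
  have hYtot : ∑ q ∈ Finset.Icc (0 : ℤ) 400, Y q ≤ (0.00146471 : ℝ) := by
    norm_num only [Nat.cast_ofNat, Nat.cast_zero, zero_add] at hIcc s0 s1 s2 s3 s4 s5 s6 s7 s8 s9 s10 s11 s12 s13 s14 s15 s16 s17 s18 b0 b1 b2 b3 b4 b5 b6 b7 b8 b9 b10 b11 b12 b13 b14 b15 b16 b17 b18 b19 ⊢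
    linarith [s0, s1, s2, s3, s4, s5, s6, s7, s8, s9, s10, s11, s12, s13, s14, s15, s16, s17, s18, b0, b1, b2, b3, b4, b5, b6, b7, b8, b9, b10, b11, b12, b13, b14, b15, b16, b17, b18, b19]
  have hsumB : ∑ q ∈ Finset.Icc (-((400 : ℕ) : ℤ)) (400 : ℕ), B q =
      (6 / 5 : ℝ) * ∑ q ∈ Finset.Icc (-((400 : ℕ) : ℤ)) (400 : ℕ), Y q +
        6 * ∑ q ∈ Finset.Icc (-((400 : ℕ) : ℤ)) (400 : ℕ), Rf q := by
    simp only [hB, Finset.sum_add_distrib, Finset.mul_sum]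
  rw [hsumB]
  have hY2 : ∑ q ∈ Finset.Icc (-((400 : ℕ) : ℤ)) (400 : ℕ), Y q ≤ 2 * (0.00146471 : ℝ) := hsymm.trans (by linarith [hYtot])
  have hfin : (6 / 5 : ℝ) * (2 * (0.00146471 : ℝ)) + 6 * (146 / 10 ^ 6) + 181 / 10 ^ 6 ≤ 46 / 10 ^ 4 := by norm_num
  linarith [hY2, hR, hfin]

end Cascade

end Summit.AnomalousDissipation.AnomalousDissipation.Theorems.SawtoothPulseCascade.K1Start
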